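import Literature.AlgebraicGeometry.Motives.JacobianFiniteIndex
import Literature.AlgebraicGeometry.Motives.JacobianDimensionOfKerRankProofs
import Literature.AlgebraicGeometry.Motives.AbelianVarietyTorsionPointsCountProofs
import Literature.NumberTheory.DiophantineGeometry.Sweep1
import HarnessLib

/-!
# `2 dim J ≤ b₁(C(ℂ))`, `b₁(A(ℂ)) = 2 dim A`, and `dim J = ½ b₁(C)` ⟺ `(f^P)^* : H¹(J) ≅ H¹(C)`

Fourth proof file of the named fact
`Literature.AlgebraicGeometry.Motives.two_mul_dim_eq_finrank_bettiCohomology` (`Motives/Jacobian`;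
Milne, *Jacobian Varieties*, Prop. 2.1 with Thm. 2.5: `2 dim J = b₁(C(ℂ))` for every Jacobian `𝒥`
of a smooth projective curve `C/ℂ`), after `JacobianDimensionProofs.lean`,
`JacobianDimensionOfKerRankProofs.lean` (this seat) and `JacobianFiniteIndex.lean` (the seat of
`isIso_bettiCohomology_map_abelJacobi`). Two inputs of those reductions have meanwhile become
theorems of the tree, and this file draws the consequences, all PROVED:

1. `deg [n]_A = n^{2g}` (`AbelianVariety.kerRank_zsmul_id_holds`, `Motives/AbelianVarietyKerRankProofs`;
   Görtz–Wedhorn II, Prop. 27.186), whence `#A[n](ℂ) = n^{2 dim A}`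
   (`AbelianVariety.natCard_torsionPoints_of_isAlgClosed_holds`,
   `Motives/AbelianVarietyTorsionPointsCountProofs`, Prop. 27.188 (1)) and — by the covering
   `x ↦ xⁿ` of `A(ℂ)`, Hurewicz and the universal coefficient theorem
   (`AbelianVariety.finrank_bettiCohomology_one_eq_of_natCard_torsionPoints`,
   `Motives/AbelianVarietyFundamentalGroup`) — **Mumford §1 (3) unconditionally**:
   `AbelianVariety.finrank_bettiCohomology_one_eq_two_mul_dim : dim_ℚ H¹(A(ℂ); ℚ) = 2 dim A`,
   `AbelianVariety.finrank_int_singularHomology_one : rk_ℤ H₁(A(ℂ); ℤ) = 2 dim A`, and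
   `H₁(A(ℂ); ℤ) ≅ ℤ^{2 dim A}`, `π₁(A(ℂ), 1) ≅ ℤ^{2 dim A}`
   (`nonempty_addEquiv_singularHomology_one`, `nonempty_mulEquiv_fundamentalGroup`).
2. `(f^P)_* π₁(C(ℂ), P)` has finite index in `π₁(J(ℂ), 1)`
   (`Jacobian.index_range_map_abelJacobi_ne_zero`, `Motives/JacobianFiniteIndex`, from the universal
   property of `Jacobian C` by covering-space theory), whence `(f^P)^*` is injective on `H¹(-; ℚ)`
   (`Jacobian.injective_bettiCohomology_map_abelJacobi_of_index_ne_zero`, `Motives/JacobianHomology`).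

Consequences recorded here:

* `Jacobian.two_mul_dim_le_finrank_bettiCohomology` — **`2 dim J ≤ b₁(C(ℂ))`, one half of Milne
  Prop. 2.1, unconditionally** (1 + 2: `2 dim J = b₁(J(ℂ)) ≤ b₁(C(ℂ))`).
* `two_mul_dim_eq_finrank_bettiCohomology_of_finrank_le` — the named fact follows from the other
  inequality `b₁(C(ℂ)) ≤ 2 dim J` alone; `two_mul_dim_eq_finrank_bettiCohomology_of_isIso` — from
  `isIso_bettiCohomology_map_abelJacobi` alone (`…_of_kerRank` with input 1 discharged);
  `isIso_bettiCohomology_map_abelJacobi_of_two_mul_dim_eq` — conversely (`…_of_facts` of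
  `Motives/JacobianFiniteIndex` with the torsion count discharged); hence
  `two_mul_dim_eq_finrank_bettiCohomology_iff_isIso` — **the two named facts of `Motives/Jacobian`
  over `ℂ` are now equivalent theorems-to-be**, their common remaining content being the inequality
  `b₁(C(ℂ)) ≤ 2 dim J(C)` (Lange §4.1.1: `rk H₁(C, ℤ) = 2g = 2 dim H⁰(ω_C)^∨`; classically Riemann's
  count of the periods of abelian integrals, Milne Thm. 2.5), isolated as the hypothesis of
  `two_mul_dim_eq_finrank_bettiCohomology_of_finrank_le` /
  `isIso_bettiCohomology_map_abelJacobi_of_finrank_le_two_mul_dim`.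

* `Jacobian.dim_le_genus`, `Jacobian.dim_eq_genus_of` — the same in the vocabulary of the docstring
  of the named fact: **`dim J ≤ g(C)` unconditionally**, and `dim J = g(C)` from the fact, where
  `g(C) = ½ b₁(C(ℂ))` is the topological genus `Literature.NumberTheory.DiophantineGeometry.genus C`.

Everything is proved; no definitions, no new named facts.

## References

* J. S. Milne, *Jacobian Varieties*, Ch. VII of Cornell–Silverman, *Arithmetic Geometry* (1986):
  §2 Prop. 2.1, Thm. 2.5. [Milne1986JacobianVarieties]
* H. Lange, *Abelian Varieties over the Complex Numbers* (2023), §4.1.1, Lemma 4.4.1.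
  [Lange2023AbelianVarietiesC]
* D. Mumford, *Abelian Varieties* (1970), §1 (3) (p. 3), §6 Application 3 (p. 64). [MumfordAV1970]
* U. Görtz, T. Wedhorn, *Algebraic Geometry II* (2023), Prop. 27.186, Prop. 27.188 (1)
  (pp. 887–888). [GortzWedhorn2023]
* A. Hatcher, *Algebraic Topology* (2002), Thm. 2A.1, §3.1 Thm. 3.2. [HatcherAT2002]
-/

noncomputable section

open CategoryTheory AlgebraicGeometry
open Literature.AlgebraicTopology.SingularHomology

namespace Literature.AlgebraicGeometry.Motives

/-! ### Complex abelian varieties: `b₁ = 2g` (Mumford §1 (3)), unconditionally -/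

/-- A finitely generated torsion-free abelian group is free of rank `rk_ℤ`: `M ≅ ℤ^{rk M}`
(structure theorem; Mathlib `Module.free_of_finite_type_torsion_free'`, `Module.finBasis`), stated for
the canonical `ℤ`-module structure of an abstract abelian group. [folklore] -/
theorem nonempty_addEquiv_pi_int_of_isAddTorsionFree (M : Type*) [AddCommGroup M] [Module.Finite ℤ M]
    [IsAddTorsionFree M] : Nonempty (M ≃+ (Fin (Module.finrank ℤ M) → ℤ)) :=
  haveI : Module.Free ℤ M := Module.free_of_finite_type_torsion_free'
  ⟨(Module.finBasis ℤ M).equivFun.toAddEquiv⟩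

namespace AbelianVariety

variable (A : AbelianVariety ℂ)

/-- **Mumford §1 (3): `b₁(A(ℂ)) = 2 dim A`** for every complex abelian variety `A`:
`dim_ℚ H¹(A(ℂ); ℚ) = 2 dim A`. Printed proof: `A(ℂ) = V/U` is a complex torus, so
`H¹(A(ℂ), ℤ) ≅ Hom(U, ℤ) ≅ ℤ^{2g}`. Here: `x ↦ xⁿ` is a covering of the compact connected commutative
group `A(ℂ)` with `#A[n](ℂ) = n^{2g}` sheets (`natCard_torsionPoints_of_isAlgClosed_holds`,
`Motives/AbelianVarietyTorsionPointsCountProofs`), so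
`[π₁ : π₁ⁿ] = n^{2g}`, `π₁ = H₁` is finitely generated and torsion-free, hence of rank `2g`
(`finrank_bettiCohomology_one_eq_of_natCard_torsionPoints`, `Motives/AbelianVarietyFundamentalGroup`).
[cite: MumfordAV1970, §1 (3) (p. 3)] -/
theorem finrank_bettiCohomology_one_eq_two_mul_dim :
    Module.finrank ℚ (bettiCohomology A.X 1) = 2 * A.dim :=
  A.finrank_bettiCohomology_one_eq_of_natCard_torsionPoints (natCard_torsionPoints_of_isAlgClosed_holds A ℂ)

/-- **`rk_ℤ H₁(A(ℂ); ℤ) = 2 dim A`** (Mumford §1 (3): `H₁(X, ℤ) ≅ U ≅ ℤ^{2g}`).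
[cite: MumfordAV1970, §1 (3) (p. 3)] -/
theorem finrank_int_singularHomology_one :
    Module.finrank ℤ (singularHomology ℤ ℤ (A.Points ℂ) 1) = 2 * A.dim := by
  have h := A.natCard_torsionPoints_eq_pow_finrank_int 2 two_ne_zero
  rw [A.natCard_torsionPoints_eq_of_charZero ℂ 2 two_ne_zero] at h
  exact (Nat.pow_right_injective le_rfl h).symm

/-- **`H₁(A(ℂ); ℤ) ≅ ℤ^{2 dim A}`** (Mumford §1 (3)): `H₁` is finitely generated
(`finite_singularHomology`) and torsion-free (`isAddTorsionFree_singularHomology_one`), hence free,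
of rank `2 dim A` (`finrank_int_singularHomology_one`). (All `ℤ`-module structures on the abelian
group `H₁` coincide, `Subsingleton (Module ℤ _)`; the isomorphism is recorded additively.)
[cite: MumfordAV1970, §1 (3) (p. 3)] -/
theorem nonempty_addEquiv_singularHomology_one :
    Nonempty (singularHomology ℤ ℤ (A.Points ℂ) 1 ≃+ (Fin (2 * A.dim) → ℤ)) := by
  have hF : @Module.Finite ℤ (singularHomology ℤ ℤ (A.Points ℂ) 1) _ _ (AddCommGroup.toIntModule _) := by
    convert A.finite_singularHomology 1
    exact Subsingleton.elim _ _
  have hrk : @Module.finrank ℤ (singularHomology ℤ ℤ (A.Points ℂ) 1) _ _ (AddCommGroup.toIntModule _) =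
      2 * A.dim := by
    convert A.finrank_int_singularHomology_one
    exact Subsingleton.elim _ _
  haveI := A.isAddTorsionFree_singularHomology_one
  obtain ⟨e⟩ := @nonempty_addEquiv_pi_int_of_isAddTorsionFree (singularHomology ℤ ℤ (A.Points ℂ) 1) _ hF _
  rw [hrk] at e
  exact ⟨e⟩

/-- **`π₁(A(ℂ), 1) ≅ ℤ^{2 dim A}`** (Mumford §1 (3): `π₁(X) = U`, a lattice in `V ≅ ℂ^g`): the
Hurewicz homomorphism of the commutative group `π₁(A(ℂ), 1)` is bijective
(`bijective_hurewiczOne`) and `H₁(A(ℂ); ℤ) ≅ ℤ^{2 dim A}`. [cite: MumfordAV1970, §1 (3) (p. 3)] -/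
theorem nonempty_mulEquiv_fundamentalGroup :
    Nonempty (FundamentalGroup (A.Points ℂ) 1 ≃* Multiplicative (Fin (2 * A.dim) → ℤ)) := by
  obtain ⟨e⟩ := A.nonempty_addEquiv_singularHomology_one
  exact ⟨(MulEquiv.ofBijective (hurewiczOne ℤ ℤ (1 : ℤ) (1 : A.Points ℂ)) A.bijective_hurewiczOne).trans
    (AddEquiv.toMultiplicative e)⟩

end AbelianVariety

/-! ### Jacobians: `2 dim J ≤ b₁(C(ℂ))` unconditionally -/

namespace Jacobian

variable {C : SchemeOver ℂ}

/-- **`2 dim J ≤ b₁(C(ℂ))` — one half of Milne, Prop. 2.1 (`dim J = g`), unconditionally**, for every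
Jacobian `𝒥` of a smooth projective curve `C/ℂ`: `2 dim J = b₁(J(ℂ))` (Mumford §1 (3),
`AbelianVariety.finrank_bettiCohomology_one_eq_two_mul_dim`) and `(f^P)^* : H¹(J(ℂ); ℚ) → H¹(C(ℂ); ℚ)`
is injective at a complex point `P` of `C` (finite index of `(f^P)_* π₁(C(ℂ))`,
`index_range_map_abelJacobi_ne_zero`, with `injective_bettiCohomology_map_abelJacobi_of_index_ne_zero`),
`H¹(C(ℂ); ℚ)` being finite-dimensional. [cite: Milne1986JacobianVarieties, §2 Prop. 2.1 and Thm. 2.5]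
[cite: Lange2023AbelianVarietiesC, §4.1.1 and Lemma 4.4.1 (proof)] -/
theorem two_mul_dim_le_finrank_bettiCohomology (hC : IsSmoothProjective 1 C) (𝒥 : Jacobian C) :
    2 * 𝒥.J.dim ≤ Module.finrank ℚ (bettiCohomology C 1) := by
  obtain ⟨P⟩ := nonempty_algPoints_of_isSmoothProjective hC
  rw [← 𝒥.J.finrank_bettiCohomology_one_eq_two_mul_dim]
  exact 𝒥.finrank_le_of_injective P hC
    (𝒥.injective_bettiCohomology_map_abelJacobi_of_index_ne_zero P
      (index_range_map_abelJacobi_ne_zero hC 𝒥 P))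

/-- `b₁(J(ℂ)) ≤ b₁(C(ℂ))` for every Jacobian of a smooth projective curve over `ℂ`.
[cite: Lange2023AbelianVarietiesC, §4.1.1 and Lemma 4.4.1 (proof)] -/
theorem finrank_bettiCohomology_le (hC : IsSmoothProjective 1 C) (𝒥 : Jacobian C) :
    Module.finrank ℚ (bettiCohomology 𝒥.J.X 1) ≤ Module.finrank ℚ (bettiCohomology C 1) := by
  rw [𝒥.J.finrank_bettiCohomology_one_eq_two_mul_dim]
  exact two_mul_dim_le_finrank_bettiCohomology hC 𝒥

/-- `(f^P)^*` is an isomorphism on `H¹(-; ℚ)` as soon as `b₁(C(ℂ)) ≤ 2 dim J` (finite index plus the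
dimension count). [cite: Lange2023AbelianVarietiesC, §4.1.1 and Lemma 4.4.1 (proof)] -/
theorem isIso_bettiCohomology_map_abelJacobi_of_finrank_le_two_mul_dim (hC : IsSmoothProjective 1 C)
    (𝒥 : Jacobian C) (P : AlgPoints C ℂ)
    (h : Module.finrank ℚ (bettiCohomology C 1) ≤ 2 * 𝒥.J.dim) :
    IsIso (bettiCohomology.map (𝒥.abelJacobi P) 1) :=
  𝒥.isIso_bettiCohomology_map_abelJacobi_of_index_ne_zero_of_finrank_le P hC
    (index_range_map_abelJacobi_ne_zero hC 𝒥 P)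
    (by rw [𝒥.J.finrank_bettiCohomology_one_eq_two_mul_dim]; exact h)

/-- `2 dim J = b₁(C(ℂ))` for one Jacobian as soon as `b₁(C(ℂ)) ≤ 2 dim J`.
[cite: Milne1986JacobianVarieties, §2 Prop. 2.1 and Thm. 2.5] -/
theorem two_mul_dim_eq_finrank_bettiCohomology_of_finrank_le_two_mul_dim (hC : IsSmoothProjective 1 C)
    (𝒥 : Jacobian C) (h : Module.finrank ℚ (bettiCohomology C 1) ≤ 2 * 𝒥.J.dim) :
    2 * 𝒥.J.dim = Module.finrank ℚ (bettiCohomology C 1) :=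
  le_antisymm (two_mul_dim_le_finrank_bettiCohomology hC 𝒥) h

end Jacobian

/-! ### The named fact: from `b₁(C) ≤ 2 dim J`, from `isIso_bettiCohomology_map_abelJacobi`, and conversely -/

/-- **`two_mul_dim_eq_finrank_bettiCohomology` follows from the inequality `b₁(C(ℂ)) ≤ 2 dim J`** for
the Jacobians of smooth projective curves over `ℂ` (the other inequality being the theorem
`Jacobian.two_mul_dim_le_finrank_bettiCohomology`). In the printed proofs this inequality is
`rk H₁(C, ℤ) = 2g` together with `dim J = dim H⁰(ω_C)^∨ = g` (Lange §4.1.1; Milne Prop. 2.1, Thm. 2.5).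
[cite: Milne1986JacobianVarieties, §2 Prop. 2.1 and Thm. 2.5] [cite: Lange2023AbelianVarietiesC, §4.1.1] -/
theorem two_mul_dim_eq_finrank_bettiCohomology_of_finrank_le
    (h : ∀ (C : SchemeOver ℂ), IsSmoothProjective 1 C → ∀ (𝒥 : Jacobian C),
      Module.finrank ℚ (bettiCohomology C 1) ≤ 2 * 𝒥.J.dim) :
    two_mul_dim_eq_finrank_bettiCohomology := fun C hC 𝒥 =>
  Jacobian.two_mul_dim_eq_finrank_bettiCohomology_of_finrank_le_two_mul_dim hC 𝒥 (h C hC 𝒥)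

/-- **`two_mul_dim_eq_finrank_bettiCohomology` from `isIso_bettiCohomology_map_abelJacobi` alone**
(`two_mul_dim_eq_finrank_bettiCohomology_of_kerRank` with `deg [n]_A = n^{2g}` discharged by
`kerRank_zsmul_id_holds`). [cite: Milne1986JacobianVarieties, §2 Prop. 2.1 and Thm. 2.5] -/
theorem two_mul_dim_eq_finrank_bettiCohomology_of_isIso (hX : isIso_bettiCohomology_map_abelJacobi) :
    two_mul_dim_eq_finrank_bettiCohomology :=
  two_mul_dim_eq_finrank_bettiCohomology_of_kerRank hX fun A => AbelianVariety.kerRank_zsmul_id_holds A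

/-- **Conversely, `isIso_bettiCohomology_map_abelJacobi` from `two_mul_dim_eq_finrank_bettiCohomology`
alone** (`isIso_bettiCohomology_map_abelJacobi_of_facts` of `Motives/JacobianFiniteIndex` with the
torsion count `#J[n](ℂ) = n^{2 dim J}` discharged). [cite: Lange2023AbelianVarietiesC, §4.1.1 and Lemma 4.4.1 (proof)] -/
theorem isIso_bettiCohomology_map_abelJacobi_of_two_mul_dim_eq
    (hT : two_mul_dim_eq_finrank_bettiCohomology) : isIso_bettiCohomology_map_abelJacobi :=
  isIso_bettiCohomology_map_abelJacobi_of_facts hT fun _ 𝒥 =>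
    AbelianVariety.natCard_torsionPoints_of_isAlgClosed_holds 𝒥.J ℂ

/-- `isIso_bettiCohomology_map_abelJacobi` from the inequality `b₁(C(ℂ)) ≤ 2 dim J`.
[cite: Lange2023AbelianVarietiesC, §4.1.1 and Lemma 4.4.1 (proof)] -/
theorem isIso_bettiCohomology_map_abelJacobi_of_finrank_le_two_mul_dim
    (h : ∀ (C : SchemeOver ℂ), IsSmoothProjective 1 C → ∀ (𝒥 : Jacobian C),
      Module.finrank ℚ (bettiCohomology C 1) ≤ 2 * 𝒥.J.dim) :
    isIso_bettiCohomology_map_abelJacobi :=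
  isIso_bettiCohomology_map_abelJacobi_of_two_mul_dim_eq (two_mul_dim_eq_finrank_bettiCohomology_of_finrank_le h)

/-- **The two named facts of `Motives/Jacobian` over `ℂ` are equivalent**: `2 dim J = b₁(C(ℂ))` for all
Jacobians of smooth projective complex curves iff `(f^P)^* : H¹(J(ℂ); ℚ) ≅ H¹(C(ℂ); ℚ)` for all of
them. [cite: Milne1986JacobianVarieties, §2 Prop. 2.1 and Thm. 2.5] [cite: Lange2023AbelianVarietiesC, §4.1.1 and Lemma 4.4.1 (proof)] -/
theorem two_mul_dim_eq_finrank_bettiCohomology_iff_isIso :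
    two_mul_dim_eq_finrank_bettiCohomology ↔ isIso_bettiCohomology_map_abelJacobi :=
  ⟨isIso_bettiCohomology_map_abelJacobi_of_two_mul_dim_eq, two_mul_dim_eq_finrank_bettiCohomology_of_isIso⟩

/-! ### In the vocabulary of the topological genus `g(C) = ½ b₁(C(ℂ))` -/

namespace Jacobian

variable {C : SchemeOver ℂ}

/-- **`dim J ≤ g(C)` unconditionally** for every Jacobian `𝒥` of a smooth projective curve `C/ℂ`,
where `g(C) = ½ dim_ℚ H¹(C(ℂ); ℚ)` is the topological genus
(`Literature.NumberTheory.DiophantineGeometry.genus`): one half of Milne, Prop. 2.1 (`dim J = g`),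
from `two_mul_dim_le_finrank_bettiCohomology`. [cite: Milne1986JacobianVarieties, §2 Prop. 2.1 and Thm. 2.5] -/
theorem dim_le_genus (hC : IsSmoothProjective 1 C) (𝒥 : Jacobian C) :
    𝒥.J.dim ≤ Literature.NumberTheory.DiophantineGeometry.genus C := by
  have h := two_mul_dim_le_finrank_bettiCohomology hC 𝒥
  unfold Literature.NumberTheory.DiophantineGeometry.genus
  omega

/-- **`dim J = g(C)`** (Milne, Prop. 2.1) for every Jacobian of a smooth projective curve over `ℂ`,
from the named fact `two_mul_dim_eq_finrank_bettiCohomology` (`2 dim J = b₁(C(ℂ))`), with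
`g(C) = ½ b₁(C(ℂ))` the topological genus. [cite: Milne1986JacobianVarieties, §2 Prop. 2.1 and Thm. 2.5] -/
theorem dim_eq_genus_of (hT : two_mul_dim_eq_finrank_bettiCohomology) (hC : IsSmoothProjective 1 C)
    (𝒥 : Jacobian C) : 𝒥.J.dim = Literature.NumberTheory.DiophantineGeometry.genus C := by
  have h := hT C hC 𝒥
  unfold Literature.NumberTheory.DiophantineGeometry.genus
  omega

/-- `dim J = g(C)` from `isIso_bettiCohomology_map_abelJacobi` (equivalently, by
`two_mul_dim_eq_finrank_bettiCohomology_iff_isIso`). [cite: Milne1986JacobianVarieties, §2 Prop. 2.1 and Thm. 2.5] -/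
theorem dim_eq_genus_of_isIso (hX : isIso_bettiCohomology_map_abelJacobi) (hC : IsSmoothProjective 1 C)
    (𝒥 : Jacobian C) : 𝒥.J.dim = Literature.NumberTheory.DiophantineGeometry.genus C :=
  dim_eq_genus_of (two_mul_dim_eq_finrank_bettiCohomology_of_isIso hX) hC 𝒥

end Jacobian

end Literature.AlgebraicGeometry.Motives

end
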